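import Summits.RiemannHypothesis.RiemannHypothesis.Theorems.MotivicDoorDecreeOffDiagonal
import Summits.RiemannHypothesis.RiemannHypothesis.Theorems.MotivicDoorAWSWindowBounds
import HarnessLib

/-!
# Motivic door (Connes–Consani): the approximate-identity kernel `K_E = v_E ∗ G` against a
# fixed divisor — sup, Lipschitz and support bounds

Honest framing (cell `pub-rhdoor`, cc-3, verbatim): "lottery ticket at the motivic door; RH
probability negligible; consolation prizes are real: a new semi-local Weil-positivity theorem, or
a located gap in the Connes–Consani programme, plus the ff-door theorem".  VERDICT (ref-1,
ref-2): `Nonempty ArithmeticWeilSurface` is a restatement of RH in structure clothing.  No RH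
content below; value = theorem (elementary real analysis on Weil tests, used by
`MotivicDoorDecreeDiagonalClass`: the decreed pairing of CC's diagonal approximants
`Δ_E = toMul u_E`, `u_E(t) = E u(Et)` (`MotivicDoorDiagonalDivergence`, `E = 1 + η`) with a
FIXED test divisor `D(g)`, `g = toMul G`, is `N(toMul K_E)` for the kernel below).

For real tests `v, G` and `E > 0` put `K_E(t) := ∫ E v(Es) G(t − s) ds` (`= (v_E ∗ G)(t)`).

PROVED
* `integral_approxConv_eq`: `K_E(t) = ∫ v(r) G(t − r/E) dr`;
* `approxConv_sub_eq`: `K_E(t) − (∫v) G(t) = ∫ v(r) (G(t − r/E) − G(t)) dr`;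
* `abs_approxConv_sub_le` (sup): `|K_E(t) − (∫v) G(t)| ≤ L₁ R ‖v‖₁ / E` if `v = 0` off
  `[−R, R]` and `|G'| ≤ L₁` (mean value theorem);
* `abs_approxConv_sub_sub_le` (Lipschitz): for `D := K_E − (∫v) G`,
  `|D(t) − D(t')| ≤ L₂ R ‖v‖₁ |t − t'| / E` if `|G''| ≤ L₂` (second differences);
* `approxConv_eq_zero` (support): `K_E(t) = 0` for `|t| > R + S` if also `G = 0` off `[−S, S]`
  and `E ≥ 1`;
* `isWeilTest_approxConv`: `K_E` is a Weil test (`isWeilTest_approxDiagonal`,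
  `isWeilTest_crossCorr`);
* bookkeeping for real Weil tests: a vanishing radius (`exists_eq_zero_of_lt_abs_of_isWeilTest`),
  a bound on `G''` (`exists_forall_abs_deriv_deriv_le_of_isWeilTest`), and the derivative bounds of
  the reflection `G(−·)` (`abs_deriv_comp_neg_le`, `abs_deriv_deriv_comp_neg_le`).

So `D = K_E − (∫v) G → 0` (rate `1/E`) in exactly the seminorms — sup norm, Lipschitz constant
at `t = 0`, with uniformly bounded support — for which `κ ↦ N(toMul κ)` is continuous
(`abs_two_mul_ccN_toMul_le`, file `MotivicDoorDecreeContinuity`).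

References: Connes–Consani, arXiv:1805.10501 §3.1 (the divisors `D(g)` and `Δ`); Connes,
arXiv:1509.05576 §4.1.
-/

noncomputable section

set_option linter.dupNamespace false

open Complex Set MeasureTheory Filter Topology Literature.NumberTheory.LFunctions
open Literature.NumberTheory.ConnesConsani2019
open scoped Real

namespace Summit.RiemannHypothesis.RiemannHypothesis.Theorems.MotivicDoor.ConnesConsani

/-! ## 1. Mean-value lemmas for the fixed divisor's additive picture `G` -/

section MeanValue

variable {G : ℝ → ℝ}

/-- `|G(x) − G(y)| ≤ L |x − y|` from `|G'| ≤ L`.  PROVED. -/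
private theorem dc_abs_sub_le (hd : Differentiable ℝ G) {L : ℝ} (hL : ∀ t, |deriv G t| ≤ L)
    (x y : ℝ) : |G x - G y| ≤ L * |x - y| := by
  have h := Convex.norm_image_sub_le_of_norm_deriv_le (f := G) (s := Set.univ) (x := y)
    (y := x) (fun z _ ↦ hd z) (fun z _ ↦ by rw [Real.norm_eq_abs]; exact hL z) convex_univ
    (mem_univ _) (mem_univ _)
  rwa [Real.norm_eq_abs, Real.norm_eq_abs] at h

/-- Second differences: `|G(x+h) − G(x) − (G(y+h) − G(y))| ≤ L |h| |x − y|` from `|G''| ≤ L`.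
PROVED. -/
private theorem dc_abs_second_diff_le (hd : Differentiable ℝ G)
    (hd' : Differentiable ℝ (deriv G)) {L : ℝ} (hL : ∀ t, |deriv (deriv G) t| ≤ L)
    (h x y : ℝ) : |G (x + h) - G x - (G (y + h) - G y)| ≤ L * |h| * |x - y| := by
  have hda : ∀ z, HasDerivAt (fun z ↦ G (z + h) - G z) (deriv G (z + h) - deriv G z) z :=
    fun z ↦ ((hd (z + h)).hasDerivAt.comp_add_const z h).sub (hd z).hasDerivAt
  have hbound : ∀ z, |deriv (fun z ↦ G (z + h) - G z) z| ≤ L * |h| := fun z ↦ by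
    rw [(hda z).deriv]
    have := dc_abs_sub_le hd' hL (z + h) z
    rwa [add_sub_cancel_left] at this
  exact dc_abs_sub_le (fun z ↦ (hda z).differentiableAt) hbound x y

/-- Derivative of the reflection `G(−·)`.  PROVED. -/
private theorem dc_deriv_comp_neg (G : ℝ → ℝ) :
    deriv (fun x ↦ G (-x)) = fun x ↦ -deriv G (-x) :=
  funext fun x ↦ deriv_comp_neg G x

/-- Second derivative of the reflection `G(−·)`.  PROVED. -/
private theorem dc_deriv_deriv_comp_neg (G : ℝ → ℝ) :
    deriv (deriv fun x ↦ G (-x)) = fun x ↦ deriv (deriv G) (-x) := by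
  rw [dc_deriv_comp_neg]
  funext x
  rw [deriv.fun_neg, deriv_comp_neg (deriv G) x, neg_neg]

/-- A bound `|G'| ≤ L₁` passes to the reflection `G(−·)`.  PROVED. -/
theorem abs_deriv_comp_neg_le {L₁ : ℝ} (hL₁ : ∀ t, |deriv G t| ≤ L₁) (t : ℝ) :
    |deriv (fun x ↦ G (-x)) t| ≤ L₁ := by
  rw [dc_deriv_comp_neg]
  show |-deriv G (-t)| ≤ L₁
  rw [abs_neg]
  exact hL₁ (-t)

/-- A bound `|G''| ≤ L₂` passes to the reflection `G(−·)`.  PROVED. -/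
theorem abs_deriv_deriv_comp_neg_le {L₂ : ℝ} (hL₂ : ∀ t, |deriv (deriv G) t| ≤ L₂) (t : ℝ) :
    |deriv (deriv fun x ↦ G (-x)) t| ≤ L₂ := by
  rw [dc_deriv_deriv_comp_neg]
  exact hL₂ (-t)

end MeanValue

/-! ## 2. The kernel `K_E = v_E ∗ G`, `v_E(t) = E v(Et)` -/

section Kernel

variable {v G : ℝ → ℝ}

/-- Substitution: `∫ E v(Es) G(t − s) ds = ∫ v(r) G(t − r/E) dr` (`E > 0`).  PROVED. -/
theorem integral_approxConv_eq (v G : ℝ → ℝ) {E : ℝ} (hE : 0 < E) (t : ℝ) :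
    ∫ s, E * v (E * s) * G (t - s) = ∫ r, v r * G (t - r / E) := by
  have h := Measure.integral_comp_mul_left (fun r ↦ v r * G (t - r / E)) E
  have e : ∀ s : ℝ, E * s / E = s := fun s ↦ mul_div_cancel_left₀ s hE.ne'
  simp only [e] at h
  have h2 : ∫ s, E * v (E * s) * G (t - s) = E * ∫ s, v (E * s) * G (t - s) := by
    rw [← integral_const_mul]
    exact integral_congr_ae (Eventually.of_forall fun s ↦ mul_assoc _ _ _)
  rw [h2, h, smul_eq_mul, abs_of_pos (inv_pos.2 hE), ← mul_assoc, mul_inv_cancel₀ hE.ne',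
    one_mul]

/-- `K_E(t) − (∫v) G(t) = ∫ v(r) (G(t − r/E) − G(t)) dr`.  PROVED. -/
theorem approxConv_sub_eq (hvc : Continuous v) (hvs : HasCompactSupport v) (hGc : Continuous G)
    {E : ℝ} (hE : 0 < E) (t : ℝ) :
    (∫ s, E * v (E * s) * G (t - s)) - (∫ s, v s) * G t =
      ∫ r, v r * (G (t - r / E) - G t) := by
  rw [integral_approxConv_eq v G hE, ← integral_mul_const, ← integral_sub]
  · exact integral_congr_ae (Eventually.of_forall fun r ↦ (mul_sub (v r) _ _).symm)
  · exact (by fun_prop : Continuous fun r ↦ v r * G (t - r / E)).integrable_of_hasCompactSupport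
      hvs.mul_right
  · exact (by fun_prop : Continuous fun r ↦ v r * G t).integrable_of_hasCompactSupport
      hvs.mul_right

/-- **Sup bound**: `|K_E(t) − (∫v) G(t)| ≤ L₁ R ‖v‖₁ / E` if `v` vanishes off `[−R, R]` and
`|G'| ≤ L₁`.  PROVED. -/
theorem abs_approxConv_sub_le (hvc : Continuous v) (hvs : HasCompactSupport v) {R : ℝ}
    (hvR : ∀ r, R < |r| → v r = 0) (hGd : Differentiable ℝ G) {L₁ : ℝ}
    (hL₁ : ∀ t, |deriv G t| ≤ L₁) {E : ℝ} (hE : 0 < E) (t : ℝ) :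
    |(∫ s, E * v (E * s) * G (t - s)) - (∫ s, v s) * G t| ≤ L₁ * R / E * ∫ r, ‖v r‖ := by
  rw [approxConv_sub_eq hvc hvs hGd.continuous hE, ← integral_const_mul]
  have h := norm_integral_le_of_norm_le (μ := volume)
    (f := fun r ↦ v r * (G (t - r / E) - G t)) (g := fun r ↦ L₁ * R / E * ‖v r‖)
    ((by fun_prop : Continuous fun r ↦ L₁ * R / E * ‖v r‖).integrable_of_hasCompactSupport
      hvs.norm.mul_left) (Eventually.of_forall fun r ↦ ?_)
  · rwa [Real.norm_eq_abs] at h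
  · show ‖v r * (G (t - r / E) - G t)‖ ≤ L₁ * R / E * ‖v r‖
    rw [norm_mul]
    by_cases hr : R < |r|
    · rw [hvR r hr, norm_zero, zero_mul, mul_zero]
    · rw [not_lt] at hr
      have h1 := dc_abs_sub_le hGd hL₁ (t - r / E) t
      rw [show t - r / E - t = -(r / E) by ring, abs_neg, abs_div, abs_of_pos hE] at h1
      rw [Real.norm_eq_abs (G _ - G _)]
      calc ‖v r‖ * |G (t - r / E) - G t| ≤ ‖v r‖ * (L₁ * (|r| / E)) :=
            mul_le_mul_of_nonneg_left h1 (norm_nonneg _)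
        _ ≤ ‖v r‖ * (L₁ * (R / E)) := by
            have hL : 0 ≤ L₁ := (abs_nonneg _).trans (hL₁ 0)
            gcongr
        _ = L₁ * R / E * ‖v r‖ := by ring

/-- **Lipschitz bound**: `|D(t) − D(t')| ≤ L₂ R ‖v‖₁ |t − t'| / E` for `D = K_E − (∫v) G`,
`|G''| ≤ L₂` (second-difference estimate).  PROVED. -/
theorem abs_approxConv_sub_sub_le (hvc : Continuous v) (hvs : HasCompactSupport v) {R : ℝ}
    (hvR : ∀ r, R < |r| → v r = 0) (hGd : Differentiable ℝ G)
    (hGd' : Differentiable ℝ (deriv G)) {L₂ : ℝ} (hL₂ : ∀ t, |deriv (deriv G) t| ≤ L₂)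
    {E : ℝ} (hE : 0 < E) (t t' : ℝ) :
    |(∫ s, E * v (E * s) * G (t - s)) - (∫ s, v s) * G t -
        ((∫ s, E * v (E * s) * G (t' - s)) - (∫ s, v s) * G t')| ≤
      L₂ * R / E * (∫ r, ‖v r‖) * |t - t'| := by
  have hGc := hGd.continuous
  have hi : ∀ t : ℝ, Integrable fun r ↦ v r * (G (t - r / E) - G t) := fun t ↦
    (by fun_prop : Continuous fun r ↦ v r * (G (t - r / E) - G t)).integrable_of_hasCompactSupport
      hvs.mul_right
  rw [approxConv_sub_eq hvc hvs hGc hE t, approxConv_sub_eq hvc hvs hGc hE t',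
    ← integral_sub (hi t) (hi t'),
    show L₂ * R / E * (∫ r, ‖v r‖) * |t - t'| = ∫ r, L₂ * R / E * |t - t'| * ‖v r‖ by
      rw [integral_const_mul]; ring]
  have h := norm_integral_le_of_norm_le (μ := volume)
    (f := fun r ↦ v r * (G (t - r / E) - G t) - v r * (G (t' - r / E) - G t'))
    (g := fun r ↦ L₂ * R / E * |t - t'| * ‖v r‖)
    ((by fun_prop : Continuous fun r ↦ L₂ * R / E * |t - t'| * ‖v r‖)
      |>.integrable_of_hasCompactSupport hvs.norm.mul_left) (Eventually.of_forall fun r ↦ ?_)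
  · rwa [Real.norm_eq_abs] at h
  · show ‖v r * (G (t - r / E) - G t) - v r * (G (t' - r / E) - G t')‖ ≤
      L₂ * R / E * |t - t'| * ‖v r‖
    rw [← mul_sub, norm_mul]
    by_cases hr : R < |r|
    · rw [hvR r hr, norm_zero, zero_mul, mul_zero]
    · rw [not_lt] at hr
      have h1 := dc_abs_second_diff_le hGd hGd' hL₂ (-(r / E)) t t'
      rw [← sub_eq_add_neg, ← sub_eq_add_neg, abs_neg, abs_div, abs_of_pos hE] at h1
      rw [Real.norm_eq_abs (_ - _)]
      calc ‖v r‖ * |G (t - r / E) - G t - (G (t' - r / E) - G t')|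
          ≤ ‖v r‖ * (L₂ * (|r| / E) * |t - t'|) := mul_le_mul_of_nonneg_left h1 (norm_nonneg _)
        _ ≤ ‖v r‖ * (L₂ * (R / E) * |t - t'|) := by
            have hL : 0 ≤ L₂ := (abs_nonneg _).trans (hL₂ 0)
            gcongr
        _ = L₂ * R / E * |t - t'| * ‖v r‖ := by ring

/-- **Support**: `K_E(t) = 0` for `|t| > R + S` if `v, G` vanish off `[−R, R]`, `[−S, S]` and
`E ≥ 1`.  PROVED. -/
theorem approxConv_eq_zero {R S : ℝ} (hvR : ∀ r, R < |r| → v r = 0)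
    (hGS : ∀ x, S < |x| → G x = 0) {E : ℝ} (hE : 1 ≤ E) {t : ℝ} (ht : R + S < |t|) :
    ∫ s, E * v (E * s) * G (t - s) = 0 := by
  rw [integral_approxConv_eq v G (by linarith) t]
  have h : ∀ r, v r * G (t - r / E) = 0 := fun r ↦ by
    by_cases hr : R < |r|
    · rw [hvR r hr, zero_mul]
    · rw [not_lt] at hr
      have h1 : |r / E| ≤ R := by
        rw [abs_div, abs_of_pos (by linarith : (0 : ℝ) < E)]
        exact (div_le_self (abs_nonneg r) hE).trans hr
      rw [hGS _ (by linarith [abs_sub_abs_le_abs_sub t (r / E)]), mul_zero]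
  simp [h]

/-- `K_E` is (the real form of) a Weil test.  PROVED. -/
theorem isWeilTest_approxConv (hv : IsWeilTest fun t ↦ (v t : ℂ))
    (hG : IsWeilTest fun t ↦ (G t : ℂ)) {E : ℝ} (hE : 0 < E) :
    IsWeilTest fun t ↦ ((∫ s, E * v (E * s) * G (t - s) : ℝ) : ℂ) := by
  have hvE : IsWeilTest fun t ↦ ((E * v (E * t) : ℝ) : ℂ) := by
    have h := isWeilTest_approxDiagonal hv (η := E - 1) (by linarith)
    have e : (1 : ℝ) + (E - 1) = E := by ring
    rw [e] at h
    exact h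
  have h := isWeilTest_crossCorr hvE (hG.comp_neg : IsWeilTest fun t ↦ ((G (-t) : ℝ) : ℂ))
  simp only [neg_sub] at h
  exact h

/-- A real Weil test vanishes off some `[−R, R]`, `R ≥ 0`.  PROVED. -/
theorem exists_eq_zero_of_lt_abs_of_isWeilTest {u : ℝ → ℝ}
    (hu : IsWeilTest fun t ↦ (u t : ℂ)) : ∃ R, 0 ≤ R ∧ ∀ r, R < |r| → u r = 0 := by
  obtain ⟨R, hR⟩ :=
    (AWS.hasCompactSupport_of_isWeilTest hu).isCompact.isBounded.subset_closedBall 0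
  refine ⟨max R 0, le_max_right _ _, fun r hr ↦ image_eq_zero_of_notMem_tsupport fun h ↦ ?_⟩
  have := hR h
  rw [Metric.mem_closedBall, dist_zero_right, Real.norm_eq_abs] at this
  linarith [le_max_left R 0]

/-- A real Weil test has a bounded second derivative.  PROVED. -/
theorem exists_forall_abs_deriv_deriv_le_of_isWeilTest {u : ℝ → ℝ}
    (hu : IsWeilTest fun t ↦ (u t : ℂ)) : ∃ L, ∀ t, |deriv (deriv u) t| ≤ L := by
  have hcd := AWS.contDiff_of_isWeilTest hu
  have h1 : ContDiff ℝ (⊤ : ℕ∞) (deriv u) := (contDiff_infty_iff_deriv.1 hcd).2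
  have hc : Continuous (deriv (deriv u)) := h1.continuous_deriv (by simp)
  have hs : HasCompactSupport (deriv (deriv u)) :=
    (AWS.hasCompactSupport_of_isWeilTest hu).deriv.deriv
  obtain ⟨C, hC⟩ := hc.bounded_above_of_compact_support hs
  exact ⟨C, fun t ↦ by simpa [Real.norm_eq_abs] using hC t⟩

end Kernel

end Summit.RiemannHypothesis.RiemannHypothesis.Theorems.MotivicDoor.ConnesConsani
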